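import Summits.QuantumFields.BalabanUV.Beta.EriceRemainderEnclosureHistoryAutonomyComparisonContinuumDirectGauge

/-!
# EriceRemainderEnclosureHistoryAutonomyComparisonContinuumAllAmplitudes — (E130) **THE SHARP STEP AT EVERY AMPLITUDE: ALGEBRAIC CORE OF
# «(E58′) IN THE CONTINUUM FOR THE SHARP `u_0`-STEP AT EVERY `η > 0`, ON EVERY TOWER, AT EVERY THRESHOLD» (direct gauge cost `≤ 24∕25`, certified;
# true supremum `(1 + 2t_P)∕4 = 0.9124`, `t_P` the plastic number).**
Continuum model of the comparison column (`HOME/b2b-balaban-beta-d4-p2/g100/README.md` §2; the direct nonlinear gauge (D′) of `g102/README.md` §4, Lean (E129)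
`…ComparisonContinuumDirectGauge`; this generation's `g103/README.md` §1–§3).  (E129) certified the gauge step `αX′ ≤ COST·X`, `COST ≤ Σ_r s_r h(x_r,y_r)`, for
amplitudes `η ≤ 0.75·Φ₀(A*)` (paper: `0.90`), the obstruction being the a-priori window-top ratio `y ≤ 1 + (1−x)ζ₀` (`ζ₀ = η∕Φ₀(ℓ⁰)`) entering `h ~ y^{3∕2}∕4`.  THE ONE NEW
INPUT (README §1): below the threshold the perturbed speed is at least the base speed AT the threshold plus the source — **`Φ_η(μ) ≥ Φ₀(A*) + η` for `μ < A*`** — because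
every memory term `L_r ℓ^η_r(μ)^{-1∕2}` only grows along the perturbed trajectory and equals the base's at `A*` (common history).  Fed into (E129)'s window-shift piece
`direct_c2_ratio_le` (ratio `ρ ≥ Φ₀(ℓ⁰)∕Φ_η(ℓ̂)`) it gives `ρ ≤ 1∕ζ₀` with the SAME `ζ₀` that bounds the window-top ratio, hence **`ρ·(y − 1) ≤ 1 − x`**, and the per-unit-share
cost becomes `F(x,y) = x∕(2y^{3∕2}) + (1∕4)·min(√y, (1−x)∕(y−1))·(y+1)(y²−x²)∕y²`, whose supremum over `0 ≤ x ≤ 1 ≤ y` is `(1+2t_P)∕4 = 0.91236…` (`t_P³ = t_P + 1`), attained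
in the limit `x → 0`, `y → t_P²` — INDEPENDENT OF THE AMPLITUDE.  So `COST ≤ 0.9124·Σ s_r < 1` at every pin for every `η`, and the continuous induction of g102 §4 (e) (on
paper, verbatim) gives (E58′) — `X = Φ_η − Φ₀ > 0` with `X∕α` non-increasing below the threshold — for the sharp `u_0`-step AT EVERY AMPLITUDE (g102: `η ≤ 0.9·Φ₀(A*)`;
g101 route (D): `0.13`).  THIS FILE is the finite, derivative-free part: (§1) **`speed_credit_le`**, **`ratio_credit_le`**, **`ratio_window_le`** (the credit and the relation
`ρ(y−1) ≤ 1−x`); (§2) **`hpolyB_le`**, **`hblockB_le`** (far windows `y ≥ 7∕4`: per-unit-share cost `≤ 24∕25` using `ρ ≤ (1−x)∕(y−1)`; true value `≤ 11∕12`); (§3)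
**`hblock_allamp_le`** (all windows: near ones by (E129) `hblock_le` with `ρ ≤ √y`, far ones by §2); (§4) **`allamp_cost_le`**, **`allamp_gauge_decreasing`** (the budget sum
over blocks and the gauge step `αX′ − X ≤ −X∕25`, now with NO amplitude hypothesis).  Numerics (README §3, `g103/kit/pilot_allamp.py`, 112 runs, `η∕Φ₀(A*)` up to 100,
window-top ratios up to 52): the new cost `≤ 0.63` on every computed pin (g102's plain cost reaches 31 there) and it dominates the measured `αX′∕X` everywhere.

Cell `pub-balaban`, β-function sub-cell, BINDER row D4 «RemainderConst leaves for Bałaban's split» (`HOME/BINDER-OWNERS.md`; owner lineage `b2b-balaban-beta-an4`;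
this file by co-owner #2 lineage `b2b-balaban-beta-d4-p2`, generation 103), β-FLOW TEAM duty (1), FREEZE (0) honoured (def-free; imports (E129) only; restates nothing).

HONEST FRAMING (page 1, verbatim and binding).  *"Discharging BetaPertH makes Bałaban's UV stability UNCONDITIONAL — a real constructive-QFT result; it is
NOT the continuum limit and NOT the Clay problem."*  THIS FILE DISCHARGES NOTHING OF THE KIND.  Elementary real algebra about abstract reals standing for the
blocks of the cell's continuum model of an abstract flow with memory — hypotheses of a census, not facts; the form, signs, ages and moments of Bałaban's (1.22)
limit functional are NOT PRINTED ([I] p. 298; GAPS G-t4-U2-1∕-2) and NOT asserted.  Row D4 class UNCHANGED (critical-path width 0; instance 0∕1; D4 DISCHARGE NO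
DATE).  HONEST DEPENDENCY: continuum YM on T⁴ ⇐ BetaPertH ∧ nine spine estimates (0/9 proved); BetaPertH ⇐ (D1) ∧ (D4) ∧ CAP+tail; G-an2-4 gates asym, D1 and
NE2/3/4.  NOT CLAIMED: the lattice statement (E58′), general (non-sharp) admissible shapes beyond g102 §4 (4), steep `u_J`-onsets, anything printed — NOT B12 Thm 2,
NOT BetaPertH, NOT continuum, NOT Clay.

WHAT IS PROVED ([folklore]; 0 `def`, 0 sorry).  §1 **`speed_credit_le`**, **`ratio_credit_le`**, **`ratio_window_le`**.  §2 **`hpolyB_le`**, **`hblockB_le`**.  §3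
**`hblock_allamp_le`**.  §4 **`allamp_cost_le`**, **`allamp_gauge_decreasing`**.
-/

noncomputable section
open Finset Real
open Summit.QuantumFields.BalabanUV.Beta.EriceRemainderEnclosureHistoryAutonomyComparisonContinuumDirectGauge

namespace Summit.QuantumFields.BalabanUV.Beta.EriceRemainderEnclosureHistoryAutonomyComparisonContinuumAllAmplitudes

/-! ## §1 The speed credit below the threshold and the relation `ρ(y−1) ≤ 1−x` -/

/-- **THE SPEED CREDIT.**  Speeds are floor + source + memory: at the threshold the base has `Φ0A = b + memA` (source off), below it the perturbed flow has
`Φη = b + η + memη`, and the memory only grows along the perturbed trajectory, which coincides with the base's down to the threshold: `memA ≤ memη`.  Hence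
`Φ0A + η ≤ Φη` — the perturbed speed anywhere below the threshold is at least the base speed AT the threshold plus the source (README §1). [folklore] -/
theorem speed_credit_le {b η memA memη Φ0A Φη : ℝ} (hA : Φ0A = b + memA) (hη : Φη = b + η + memη) (hmem : memA ≤ memη) : Φ0A + η ≤ Φη := by
  rw [hA, hη]; linarith

/-- **THE RATIO WITH THE CREDIT.**  If the perturbed speed `Φh` at the cap of a window is at least `Φ0A + η` (`speed_credit_le`; `Φ0A ≥ 0`) and the amplitude is
`η = ζ0·Φ0t` relative to the base speed `Φ0t ≥ 0` at the base top (`ζ0 > 0`), then `Φ0t ≤ (1∕ζ0)·Φh` — the ratio `ρ = 1∕ζ0` for (E129) `direct_c2_ratio_le`. [folklore] -/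
theorem ratio_credit_le {Φ0t Φ0A Φh η ζ0 : ℝ} (hζ0 : 0 < ζ0) (hΦ0A : 0 ≤ Φ0A) (hη : η = ζ0 * Φ0t) (hcredit : Φ0A + η ≤ Φh) :
    Φ0t ≤ 1 / ζ0 * Φh := by
  have h1 : ζ0 * Φ0t ≤ Φh := by rw [← hη]; linarith
  rw [one_div, ← div_eq_inv_mul, le_div_iff₀ hζ0]
  linarith

/-- **`ρ(y−1) ≤ 1−x`.**  The window-top ratio obeys `y − 1 ≤ (1−x)·ζ0` ((E129) `top_ratio_le`) and the speed ratio obeys `ρ ≤ 1∕ζ0` (`ratio_credit_le`) with the SAME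
`ζ0 > 0`; hence `ρ·(y−1) ≤ 1 − x` (`ρ ≥ 0`, `x ≤ 1`) — the amplitude drops out. [folklore] -/
theorem ratio_window_le {ρ y x ζ0 : ℝ} (hζ0 : 0 < ζ0) (hρ : 0 ≤ ρ) (hx1 : x ≤ 1) (hy : y - 1 ≤ (1 - x) * ζ0) (hρζ : ρ ≤ 1 / ζ0) :
    ρ * (y - 1) ≤ 1 - x := by
  rcases le_or_gt 1 y with hy1 | hy1
  · have h1 : ρ * (y - 1) ≤ 1 / ζ0 * (y - 1) := mul_le_mul_of_nonneg_right hρζ (by linarith)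
    have h2 : 1 / ζ0 * (y - 1) ≤ 1 / ζ0 * ((1 - x) * ζ0) := mul_le_mul_of_nonneg_left hy (by positivity)
    have e : 1 / ζ0 * ((1 - x) * ζ0) = 1 - x := by field_simp
    linarith [e.le]
  · have : ρ * (y - 1) ≤ 0 := mul_nonpos_of_nonneg_of_nonpos hρ (by linarith)
    linarith

/-! ## §2 Far windows: `y ≥ 7∕4` with the credit ratio -/

/-- `25·[2xt(t²−1) + (1−x)(t²+1)(t⁴−x²)] ≤ 96·t⁴(t²−1)` for `0 ≤ x ≤ 1`, `t ≥ 1`, `t² ≥ 7∕4` — i.e. with `y = t²` and `ρ = (1−x)∕(y−1)`: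
`x∕(2y^{3∕2}) + (ρ∕4)(y+1)(y²−x²)∕y² ≤ 24∕25` on the far windows (true supremum `11∕12`, at `x = 0`, `y = 7∕4`).  Proof: the `x = 0` margin is `t⁴(71t² − 121) ≥ 0`
and the `x`-terms have the good sign since `(t²+1)(t⁴ + x − x²) ≥ 2t(t²−1)`. [folklore] -/
theorem hpolyB_le {x t : ℝ} (hx0 : 0 ≤ x) (hx1 : x ≤ 1) (ht1 : 1 ≤ t) (ht : 7 / 4 ≤ t ^ 2) :
    25 * (2 * x * t * (t ^ 2 - 1) + (1 - x) * (t ^ 2 + 1) * (t ^ 4 - x ^ 2)) ≤ 96 * (t ^ 4 * (t ^ 2 - 1)) := by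
  -- rewrite the margin as  t⁴(71t² − 121) + 25·x·[(t²+1)(t⁴ + x − x²) − 2t(t²−1)]
  have key : 96 * (t ^ 4 * (t ^ 2 - 1)) - 25 * (2 * x * t * (t ^ 2 - 1) + (1 - x) * (t ^ 2 + 1) * (t ^ 4 - x ^ 2))
      = t ^ 4 * (71 * t ^ 2 - 121) + 25 * x * ((t ^ 2 + 1) * (t ^ 4 + x - x ^ 2) - 2 * t * (t ^ 2 - 1)) := by ring
  have hA : 0 ≤ t ^ 4 * (71 * t ^ 2 - 121) := by
    have : 0 ≤ 71 * t ^ 2 - 121 := by linarith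
    positivity
  have hxx : 0 ≤ x - x ^ 2 := by nlinarith
  have ht0 : 0 ≤ t := by linarith
  have hB : 2 * t * (t ^ 2 - 1) ≤ (t ^ 2 + 1) * (t ^ 4 + x - x ^ 2) := by
    -- 2t(t²−1) ≤ 2t²·t² ≤ (t²+1)t⁴ ≤ (t²+1)(t⁴ + x − x²)
    have h1 : 2 * t * (t ^ 2 - 1) ≤ 2 * t ^ 4 := by nlinarith [mul_nonneg ht0 (sub_nonneg.mpr ht1)]
    have h2 : 2 * t ^ 4 ≤ (t ^ 2 + 1) * t ^ 4 := by nlinarith [pow_nonneg ht0 4]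
    have h3 : (t ^ 2 + 1) * t ^ 4 ≤ (t ^ 2 + 1) * (t ^ 4 + x - x ^ 2) := by nlinarith
    linarith
  have hC : 0 ≤ 25 * x * ((t ^ 2 + 1) * (t ^ 4 + x - x ^ 2) - 2 * t * (t ^ 2 - 1)) := by
    have : 0 ≤ (t ^ 2 + 1) * (t ^ 4 + x - x ^ 2) - 2 * t * (t ^ 2 - 1) := by linarith
    positivity
  linarith [key.ge]

/-- **FAR WINDOWS COST `≤ 24∕25`.**  For `0 ≤ x ≤ 1`, `y ≥ 7∕4`, `t > 0`, `t² = y`, and a ratio `ρ` with `ρ·(y−1) ≤ 1−x` (`ratio_window_le`):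
`(1∕2)·x∕(y·t) + (1∕4)·ρ·(y+1)(y²−x²)∕y² ≤ 24∕25` — the per-unit-share sum of (E129) `direct_c1_le` and `direct_c2_ratio_le`. [folklore] -/
theorem hblockB_le {x y t ρ : ℝ} (hx0 : 0 ≤ x) (hx1 : x ≤ 1) (hy : 7 / 4 ≤ y) (ht : 0 < t) (hty : t ^ 2 = y)
    (hρy : ρ * (y - 1) ≤ 1 - x) :
    1 / 2 * (x / (y * t)) + 1 / 4 * (ρ * ((y + 1) * (y ^ 2 - x ^ 2) / y ^ 2)) ≤ 24 / 25 := by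
  have hy0 : 0 < y := by linarith
  have ht1 : 1 ≤ t := by nlinarith
  have hty' : 7 / 4 ≤ t ^ 2 := by rw [hty]; exact hy
  have hgeo : 0 ≤ (y + 1) * (y ^ 2 - x ^ 2) / y ^ 2 := by
    have : 0 ≤ y ^ 2 - x ^ 2 := by nlinarith
    positivity
  -- replace ρ by (1−x)/(y−1)
  have hρ' : ρ ≤ (1 - x) / (y - 1) := by rw [le_div_iff₀ (by linarith)]; exact hρy
  have step : 1 / 4 * (ρ * ((y + 1) * (y ^ 2 - x ^ 2) / y ^ 2)) ≤ 1 / 4 * ((1 - x) / (y - 1) * ((y + 1) * (y ^ 2 - x ^ 2) / y ^ 2)) := by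
    have := mul_le_mul_of_nonneg_right hρ' hgeo
    linarith
  have hp := hpolyB_le hx0 hx1 ht1 hty'
  have e : 1 / 2 * (x / (y * t)) + 1 / 4 * ((1 - x) / (y - 1) * ((y + 1) * (y ^ 2 - x ^ 2) / y ^ 2))
      = (2 * x * t * (t ^ 2 - 1) + (1 - x) * (t ^ 2 + 1) * (t ^ 4 - x ^ 2)) / (4 * (t ^ 4 * (t ^ 2 - 1))) := by
    have hne : t ^ 2 - 1 ≠ 0 := by nlinarith
    rw [← hty]; field_simp; ring
  have hden : 0 < 4 * (t ^ 4 * (t ^ 2 - 1)) := by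
    have : 0 < t ^ 2 - 1 := by nlinarith
    positivity
  have fin : (2 * x * t * (t ^ 2 - 1) + (1 - x) * (t ^ 2 + 1) * (t ^ 4 - x ^ 2)) / (4 * (t ^ 4 * (t ^ 2 - 1))) ≤ 24 / 25 := by
    rw [div_le_iff₀ hden]; linarith
  linarith [e.le, e.ge]

/-! ## §3 All windows -/

/-- **THE PER-UNIT-SHARE COST IS AT MOST `24∕25` — NO AMPLITUDE HYPOTHESIS.**  For `0 ≤ x ≤ 1 ≤ y`, `t > 0`, `t² = y`, and a speed ratio `ρ ≤ t` (`Φ₀(ℓ⁰)∕Φ_η(ℓ̂) ≤ √y`,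
g102 §4 (d)) with `ρ·(y−1) ≤ 1−x` (§1): `(1∕2)·x∕(y·t) + (1∕4)·ρ·(y+1)(y²−x²)∕y² ≤ 24∕25`.  Near windows (`y ≤ 7∕4`) by (E129) `hblock_le` with `ρ ≤ t`, far ones by
`hblockB_le`.  (True supremum `(1+2t_P)∕4 = 0.9124`, README §2.) [folklore] -/
theorem hblock_allamp_le {x y t ρ : ℝ} (hx0 : 0 ≤ x) (hx1 : x ≤ 1) (hy1 : 1 ≤ y) (ht : 0 < t) (hty : t ^ 2 = y) (hρt : ρ ≤ t)
    (hρy : ρ * (y - 1) ≤ 1 - x) :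
    1 / 2 * (x / (y * t)) + 1 / 4 * (ρ * ((y + 1) * (y ^ 2 - x ^ 2) / y ^ 2)) ≤ 24 / 25 := by
  rcases le_or_gt y (7 / 4) with hy | hy
  · have hy0 : 0 < y := by linarith
    have hgeo : 0 ≤ (y + 1) * (y ^ 2 - x ^ 2) / y ^ 2 := by
      have : 0 ≤ y ^ 2 - x ^ 2 := by nlinarith
      positivity
    have step : 1 / 4 * (ρ * ((y + 1) * (y ^ 2 - x ^ 2) / y ^ 2)) ≤ 1 / 4 * (t * ((y + 1) * (y ^ 2 - x ^ 2) / y ^ 2)) := by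
      have := mul_le_mul_of_nonneg_right hρt hgeo
      linarith
    have e : t * ((y + 1) * (y ^ 2 - x ^ 2) / y ^ 2) = (y + 1) * (y ^ 2 - x ^ 2) / (y * t) := by
      have hy2 : y ^ 2 = y * t * t := by rw [← hty]; ring
      rw [hy2]; field_simp
    have hb := hblock_le hx1 hy1 hy ht hty
    rw [e] at step
    linarith
  · exact hblockB_le hx0 hx1 hy.le ht hty hρy

/-! ## §4 The budget sum and the gauge step -/

variable {ι : Type*}

/-- **THE DIRECT COST IS AT MOST `24∕25` AT EVERY AMPLITUDE.**  Blocks `r ∈ S` at the pin with base shares `s_r ≥ 0`, `Σ s_r ≤ 1`, each with `0 ≤ x_r ≤ 1 ≤ y_r`, `t_r > 0`,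
`t_r² = y_r`, a speed ratio `ρ_r ≤ t_r` with `ρ_r(y_r − 1) ≤ 1 − x_r`, and per-block pieces `c1_r ≤ (s_r∕2)·x_r∕(y_rt_r)` ((E129) `direct_c1_le`),
`c2_r ≤ (s_r∕4)·ρ_r(y_r+1)(y_r²−x_r²)∕y_r²` ((E129) `direct_c2_ratio_le`).  Then `Σ_r (c1_r + c2_r) ≤ 24∕25`. [folklore] -/
theorem allamp_cost_le (S : Finset ι) {s x y t ρ c1 c2 : ι → ℝ} (hs : ∀ r ∈ S, 0 ≤ s r) (hsum : ∑ r ∈ S, s r ≤ 1)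
    (hx0 : ∀ r ∈ S, 0 ≤ x r) (hx1 : ∀ r ∈ S, x r ≤ 1) (hy1 : ∀ r ∈ S, 1 ≤ y r) (ht : ∀ r ∈ S, 0 < t r) (hty : ∀ r ∈ S, t r ^ 2 = y r)
    (hρt : ∀ r ∈ S, ρ r ≤ t r) (hρy : ∀ r ∈ S, ρ r * (y r - 1) ≤ 1 - x r)
    (hc1 : ∀ r ∈ S, c1 r ≤ s r / 2 * (x r / (y r * t r))) (hc2 : ∀ r ∈ S, c2 r ≤ s r / 4 * (ρ r * ((y r + 1) * (y r ^ 2 - x r ^ 2) / y r ^ 2))) :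
    ∑ r ∈ S, (c1 r + c2 r) ≤ 24 / 25 := by
  have hterm : ∀ r ∈ S, c1 r + c2 r ≤ s r * (24 / 25) := by
    intro r hr
    have hb := hblock_allamp_le (hx0 r hr) (hx1 r hr) (hy1 r hr) (ht r hr) (hty r hr) (hρt r hr) (hρy r hr)
    have e : s r / 2 * (x r / (y r * t r)) + s r / 4 * (ρ r * ((y r + 1) * (y r ^ 2 - x r ^ 2) / y r ^ 2))
        = s r * (1 / 2 * (x r / (y r * t r)) + 1 / 4 * (ρ r * ((y r + 1) * (y r ^ 2 - x r ^ 2) / y r ^ 2))) := by ring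
    have := mul_le_mul_of_nonneg_left hb (hs r hr)
    linarith [hc1 r hr, hc2 r hr, e.le, e.ge]
  calc ∑ r ∈ S, (c1 r + c2 r) ≤ ∑ r ∈ S, s r * (24 / 25) := sum_le_sum hterm
    _ = (∑ r ∈ S, s r) * (24 / 25) := by rw [sum_mul]
    _ ≤ 1 * (24 / 25) := mul_le_mul_of_nonneg_right hsum (by norm_num)
    _ = 24 / 25 := one_mul _

/-- **THE GAUGE STEP AT EVERY AMPLITUDE.**  If `α·X′ ≤ X·C` (the derivative identity of g102 §4 (d), pieces summed: `C = Σ_r (c1_r + c2_r)`), the blocks satisfy the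
hypotheses of `allamp_cost_le`, and `X ≥ 0` at the pin, then `α·X′ − X ≤ −X∕25`: the level gauge `X∕α` strictly decreases going up while `X > 0` — the inequality the
continuous induction (README §2 (e)) propagates from the threshold to every pin, for EVERY amplitude `η > 0`. [folklore] -/
theorem allamp_gauge_decreasing (S : Finset ι) {s x y t ρ c1 c2 : ι → ℝ} {α X Xp : ℝ} (hs : ∀ r ∈ S, 0 ≤ s r) (hsum : ∑ r ∈ S, s r ≤ 1)
    (hx0 : ∀ r ∈ S, 0 ≤ x r) (hx1 : ∀ r ∈ S, x r ≤ 1) (hy1 : ∀ r ∈ S, 1 ≤ y r) (ht : ∀ r ∈ S, 0 < t r) (hty : ∀ r ∈ S, t r ^ 2 = y r)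
    (hρt : ∀ r ∈ S, ρ r ≤ t r) (hρy : ∀ r ∈ S, ρ r * (y r - 1) ≤ 1 - x r)
    (hc1 : ∀ r ∈ S, c1 r ≤ s r / 2 * (x r / (y r * t r))) (hc2 : ∀ r ∈ S, c2 r ≤ s r / 4 * (ρ r * ((y r + 1) * (y r ^ 2 - x r ^ 2) / y r ^ 2)))
    (hXp : α * Xp ≤ X * ∑ r ∈ S, (c1 r + c2 r)) (hX : 0 ≤ X) : α * Xp - X ≤ -(1 / 25) * X :=
  direct_gauge_decreasing hXp (allamp_cost_le S hs hsum hx0 hx1 hy1 ht hty hρt hρy hc1 hc2) hX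

end Summit.QuantumFields.BalabanUV.Beta.EriceRemainderEnclosureHistoryAutonomyComparisonContinuumAllAmplitudes

end
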